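import Literature.Barriers.AtomisticToContinuum.DisorderedHarmonicChainDensityUpperBounds
import Mathlib.MeasureTheory.Integral.IntervalIntegral.IntegrationByParts
import Mathlib.MeasureTheory.Integral.IntervalIntegral.Periodic
import Mathlib.MeasureTheory.Integral.DominatedConvergence
import HarnessLib

/-!
# Ajanki–Huveneers 2011, towards Prop. 5.1 (5.2): the uniform start is almost sub-invariant

First file of the lower bound (5.2) of Prop. 5.1 of O. Ajanki, F. Huveneers, CMP **301** (2011)
841–883, arXiv:1003.1076 ("`𝔼(u(X^x_n)) ≥ K' ∫_𝕋 u`, `1/2 ≤ w²n ≤ 1`", here for the untilted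
chain, which is all §6.1 uses). The paper's "third observation" in the proof of Prop. 5.1 —
"`T^{n''}1 ∼ 1` directly follows from the definition of `T`, Azuma's bound and `w²n ≤ 1`" — is the
statement that the chain started from the UNIFORM distribution on `𝕋` keeps a density bounded
below. We PROVE the clean form

  `∫_0^1 𝔼 u(X^y_n) dy ≥ (1 - Cw²)ⁿ ∫_0^1 u`   (`u ≥ 0` continuous `1`-periodic)

(`uniform_start_lower`): one step is the change of variables `z = f_b(y)`, `dy = P(y,δ_b) dz`
with `P = 1 - 2δ_b sin 2πy + 2δ_b²(1 - cos 2πy) ≥ 1 - 2δ_b sin 2πy`, and `𝔼δ_b = 0` kills the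
first-order term up to `|sin 2πy - sin 2π(f_b(y) - ϑ)| ≤ 2π|Φ| = 𝒪(w)` (`one_step_lower`,
`one_step_lower_mean`); then induction over the Markov structure (`integral_pi_succ_cons`,
`ahPhase_finExt_cons`).

[cite: AjankiHuveneers2011, proof of Prop. 5.1, third observation (`T^{n''}1 ∼ 1`); Lemma 3.2 eq. (3.10)]
-/

noncomputable section

open Real MeasureTheory Set Filter Function
open scoped ENNReal

namespace Literature.Barriers.AtomisticToContinuum.HeatConduction

/-! ### Shift-equivariance of the lifted chain -/

section Shift

/-- `X^{x+1}_n = X^x_n + 1`. [folklore] -/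
theorem ahPhase_add_one (w x : ℝ) (B : ℕ → ℝ) : ∀ n, ahPhase w (x + 1) B n = ahPhase w x B n + 1
  | 0 => rfl
  | n + 1 => by rw [ahPhase_succ, ahPhase_succ, ahPhase_add_one w x B n, ahStep_add_one]

end Shift

/-! ### Bochner integration against `ν^{⊗(m+1)} = ν ⊗ ν^{⊗m}` along `Fin.cons` -/

section Cons

/-- `∫ g dν^{⊗(m+1)} = ∫ (∫ g(b :: y) ν^{⊗m}(dy)) ν(db)` for integrable `g`. [folklore] -/
theorem integral_pi_succ_cons (ν : Measure ℝ) [IsProbabilityMeasure ν] (m : ℕ)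
    {g : (Fin (m + 1) → ℝ) → ℝ} (hg : Integrable g (Measure.pi fun _ : Fin (m + 1) => ν)) :
    ∫ x, g x ∂(Measure.pi fun _ : Fin (m + 1) => ν) =
      ∫ b, ∫ y, g (Fin.cons b y) ∂(Measure.pi fun _ : Fin m => ν) ∂ν := by
  set e := MeasurableEquiv.piFinSuccAbove (fun _ : Fin (m + 1) => ℝ) 0 with he
  have hmp := MeasurePreserving.symm _ (measurePreserving_piFinSuccAbove (fun _ : Fin (m + 1) => ν) 0)
  have h1 : ∫ x, g x ∂(Measure.pi fun _ : Fin (m + 1) => ν) =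
      ∫ p, g (e.symm p) ∂(ν.prod (Measure.pi fun _ : Fin m => ν)) :=
    (hmp.integral_comp e.symm.measurableEmbedding g).symm
  have hint : Integrable (fun p : ℝ × (Fin m → ℝ) => g (e.symm p)) (ν.prod (Measure.pi fun _ : Fin m => ν)) :=
    (hmp.integrable_comp_emb e.symm.measurableEmbedding).mpr hg
  rw [h1, integral_prod _ hint]
  refine integral_congr_ae (ae_of_all _ fun b => integral_congr_ae (ae_of_all _ fun y => ?_))
  show g (e.symm (b, y)) = g (Fin.cons b y)
  simp only [he, MeasurableEquiv.piFinSuccAbove_symm_apply]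
  simp [Fin.insertNthEquiv, Fin.insertNth_zero']

end Cons

/-! ### One step: the change of variables `z = f_b(y)` -/

section OneStep

variable {w b : ℝ}

/-- **Change of variables over one period**: for continuous `1`-periodic `G`,
`∫_0^1 G(f_b(y)) f_b'(y) dy = ∫_0^1 G` (`f_b' = 1/P(·, δ_b) > 0`, `f_b(1) = f_b(0) + 1`).
[cite: AjankiHuveneers2011, Lemma 3.2 eq. (3.10)] -/
theorem one_step_cov (hw0 : 0 ≤ w) (hw : π * w / 2 < 1) (hδ : |igDelta w b| < 1) {G : ℝ → ℝ}
    (hG : Continuous G) (hGper : Function.Periodic G 1) :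
    ∫ y in (0:ℝ)..1, G (ahStep w b y) * (1 / pcP y (igDelta w b)) = ∫ z in (0:ℝ)..1, G z := by
  have hd : ∀ y ∈ Set.uIcc (0:ℝ) 1, HasDerivAt (ahStep w b) (1 / pcP y (igDelta w b)) y :=
    fun y _ => hasDerivAt_ahStep_x hw0 hw hδ y
  have hc : ContinuousOn (fun y => 1 / pcP y (igDelta w b)) (Set.uIcc (0:ℝ) 1) := by
    refine Continuous.continuousOn ?_
    refine continuous_const.div ?_ fun y => (pcP_pos _ _).ne'
    exact continuous_pcP_uncurry.comp (continuous_id.prodMk continuous_const)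
  have h := intervalIntegral.integral_comp_mul_deriv hd hc hG
  rw [show (fun y => (G ∘ ahStep w b) y * (1 / pcP y (igDelta w b))) =
      fun y => G (ahStep w b y) * (1 / pcP y (igDelta w b)) from rfl] at h
  rw [h, show ahStep w b 1 = ahStep w b 0 + 1 by rw [← ahStep_add_one, zero_add],
    hGper.intervalIntegral_add_eq (ahStep w b 0) 0, zero_add]

/-- **One step, lower bound**: for continuous `1`-periodic `G ≥ 0`, with `I = ∫_0^1 G`,
`A = ∫_0^1 G(z) sin 2π(z - ϑ) dz` and `|Φ(·, b)| ≤ C_Φ w`: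
`∫_0^1 G(f_b(y)) dy ≥ I - 2δ_b A - 4π C_Φ w |δ_b| I`. [cite: AjankiHuveneers2011, proof of Prop. 5.1, third observation] -/
theorem one_step_lower (hw0 : 0 ≤ w) (hw : π * w / 2 < 1) (hδ : |igDelta w b| < 1) {G : ℝ → ℝ}
    (hG : Continuous G) (hGper : Function.Periodic G 1) (hG0 : ∀ y, 0 ≤ G y) {CΦ : ℝ}
    (hΦ : ∀ y, |ahPhi w y b| ≤ CΦ * w) :
    (∫ z in (0:ℝ)..1, G z) - 2 * igDelta w b * (∫ z in (0:ℝ)..1, G z * Real.sin (2 * π * (z - ahTheta w))) -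
        4 * π * CΦ * w * |igDelta w b| * (∫ z in (0:ℝ)..1, G z) ≤
      ∫ y in (0:ℝ)..1, G (ahStep w b y) := by
  set δ := igDelta w b with hδdef
  set f := ahStep w b with hf
  set P : ℝ → ℝ := fun y => pcP y δ with hP
  have hP0 : ∀ y, 0 < P y := fun y => pcP_pos _ _
  set I : ℝ := ∫ z in (0:ℝ)..1, G z with hI
  set A : ℝ := ∫ z in (0:ℝ)..1, G z * Real.sin (2 * π * (z - ahTheta w)) with hA
  have hI0 : 0 ≤ I := intervalIntegral.integral_nonneg zero_le_one fun z _ => hG0 z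
  have hCΦ0 : 0 ≤ CΦ * w := (abs_nonneg _).trans (hΦ 0)
  -- continuity facts
  have hfc : Continuous f := by
    have : ∀ y, HasDerivAt f (1 / pcP y δ) y := fun y => hasDerivAt_ahStep_x hw0 hw hδ y
    exact continuous_iff_continuousAt.mpr fun y => (this y).continuousAt
  have hPc : Continuous P := continuous_pcP_uncurry.comp (continuous_id.prodMk continuous_const)
  have hinvc : Continuous fun y => 1 / P y := continuous_const.div hPc fun y => (hP0 y).ne'
  have hGf : Continuous fun y => G (f y) := hG.comp hfc
  have hsin : Continuous fun y : ℝ => Real.sin (2 * π * y) := by fun_prop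
  have hsinθ : Continuous fun z : ℝ => Real.sin (2 * π * (z - ahTheta w)) := by fun_prop
  -- the two changes of variables
  have hcov1 : ∫ y in (0:ℝ)..1, G (f y) * (1 / P y) = I := one_step_cov hw0 hw hδ hG hGper
  have hper2 : Function.Periodic (fun z => G z * Real.sin (2 * π * (z - ahTheta w))) 1 := fun z => by
    simp only [hGper z]
    rw [show 2 * π * (z + 1 - ahTheta w) = 2 * π * (z - ahTheta w) + 2 * π by ring, Real.sin_add_two_pi]
  have hcov2 : ∫ y in (0:ℝ)..1, G (f y) * Real.sin (2 * π * (f y - ahTheta w)) * (1 / P y) = A :=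
    one_step_cov hw0 hw hδ (show Continuous fun z => G z * Real.sin (2 * π * (z - ahTheta w)) by fun_prop) hper2
  -- pointwise: `G(f y) ≥ G(f y) f'(y) (1 - 2δ sin 2πy)`
  have hpt : ∀ y, G (f y) * (1 / P y) * (1 - 2 * δ * Real.sin (2 * π * y)) ≤ G (f y) := by
    intro y
    have hPy := hP0 y
    have hPdef : P y = 1 - 2 * δ * Real.sin (2 * π * y) + 2 * δ ^ 2 * (1 - Real.cos (2 * π * y)) := rfl
    have h2 : 1 - 2 * δ * Real.sin (2 * π * y) ≤ P y := by
      rw [hPdef]; nlinarith [Real.cos_le_one (2 * π * y), sq_nonneg δ]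
    calc G (f y) * (1 / P y) * (1 - 2 * δ * Real.sin (2 * π * y))
        ≤ G (f y) * (1 / P y) * P y :=
          mul_le_mul_of_nonneg_left h2 (mul_nonneg (hG0 _) (by positivity))
      _ = G (f y) := by field_simp
  -- `|sin 2πy - sin 2π(f y - ϑ)| ≤ 2π C_Φ w`
  have hsin_diff : ∀ y, |Real.sin (2 * π * y) - Real.sin (2 * π * (f y - ahTheta w))| ≤ 2 * π * (CΦ * w) := by
    intro y
    have h1 := Real.abs_sin_sub_sin_le (2 * π * y) (2 * π * (f y - ahTheta w))
    have h2 : |2 * π * y - 2 * π * (f y - ahTheta w)| = 2 * π * |ahPhi w y b| := by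
      rw [show 2 * π * y - 2 * π * (f y - ahTheta w) = -(2 * π) * ahPhi w y b by
        simp only [hf]; unfold ahStep; ring, abs_mul, abs_neg, abs_of_pos Real.two_pi_pos]
    rw [h2] at h1
    exact h1.trans (mul_le_mul_of_nonneg_left (hΦ y) Real.two_pi_pos.le)
  -- integrate
  have cA : Continuous fun y => G (f y) * (1 / P y) * (1 - 2 * δ * Real.sin (2 * π * y)) := by fun_prop
  have cB : Continuous fun y => G (f y) * (1 / P y) * Real.sin (2 * π * y) := by fun_prop
  have cC : Continuous fun y => G (f y) * Real.sin (2 * π * (f y - ahTheta w)) * (1 / P y) := by fun_prop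
  have cD : Continuous fun y => G (f y) * (1 / P y) := by fun_prop
  have hint1 : IntervalIntegrable (fun y => G (f y) * (1 / P y) * (1 - 2 * δ * Real.sin (2 * π * y))) volume 0 1 :=
    cA.intervalIntegrable _ _
  have hstep1 : ∫ y in (0:ℝ)..1, G (f y) * (1 / P y) * (1 - 2 * δ * Real.sin (2 * π * y)) ≤
      ∫ y in (0:ℝ)..1, G (f y) :=
    intervalIntegral.integral_mono_on zero_le_one hint1 (hGf.intervalIntegrable _ _) fun y _ => hpt y
  -- expand the left-hand side
  have hX : |(∫ y in (0:ℝ)..1, G (f y) * (1 / P y) * Real.sin (2 * π * y)) - A| ≤ 2 * π * (CΦ * w) * I := by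
    rw [← hcov2, ← intervalIntegral.integral_sub (cB.intervalIntegrable _ _) (cC.intervalIntegrable _ _)]
    have heq : ∀ y, G (f y) * (1 / P y) * Real.sin (2 * π * y) -
        G (f y) * Real.sin (2 * π * (f y - ahTheta w)) * (1 / P y) =
        G (f y) * (1 / P y) * (Real.sin (2 * π * y) - Real.sin (2 * π * (f y - ahTheta w))) := fun y => by ring
    simp_rw [heq]
    calc |∫ y in (0:ℝ)..1, G (f y) * (1 / P y) * (Real.sin (2 * π * y) - Real.sin (2 * π * (f y - ahTheta w)))|
        ≤ ∫ y in (0:ℝ)..1, |G (f y) * (1 / P y) * (Real.sin (2 * π * y) - Real.sin (2 * π * (f y - ahTheta w)))| :=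
          intervalIntegral.abs_integral_le_integral_abs zero_le_one
      _ ≤ ∫ y in (0:ℝ)..1, G (f y) * (1 / P y) * (2 * π * (CΦ * w)) := by
          refine intervalIntegral.integral_mono_on zero_le_one ?_ ?_ fun y _ => ?_
          · exact (show Continuous fun y => |G (f y) * (1 / P y) *
              (Real.sin (2 * π * y) - Real.sin (2 * π * (f y - ahTheta w)))| by fun_prop).intervalIntegrable _ _
          · exact (show Continuous fun y => G (f y) * (1 / P y) * (2 * π * (CΦ * w)) by fun_prop).intervalIntegrable _ _
          · rw [abs_mul, abs_of_nonneg (mul_nonneg (hG0 _) (by have := hP0 y; positivity))]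
            exact mul_le_mul_of_nonneg_left (hsin_diff y) (mul_nonneg (hG0 _) (by have := hP0 y; positivity))
      _ = 2 * π * (CΦ * w) * I := by
          rw [intervalIntegral.integral_mul_const, hcov1]; ring
  have hlhs : ∫ y in (0:ℝ)..1, G (f y) * (1 / P y) * (1 - 2 * δ * Real.sin (2 * π * y)) =
      I - 2 * δ * ∫ y in (0:ℝ)..1, G (f y) * (1 / P y) * Real.sin (2 * π * y) := by
    have heq : ∀ y, G (f y) * (1 / P y) * (1 - 2 * δ * Real.sin (2 * π * y)) =
        G (f y) * (1 / P y) - 2 * δ * (G (f y) * (1 / P y) * Real.sin (2 * π * y)) := fun y => by ring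
    simp_rw [heq]
    rw [intervalIntegral.integral_sub (cD.intervalIntegrable _ _)
      ((show Continuous fun y => 2 * δ * (G (f y) * (1 / P y) * Real.sin (2 * π * y)) by fun_prop).intervalIntegrable _ _),
      intervalIntegral.integral_const_mul, hcov1]
  rw [hlhs] at hstep1
  set X := ∫ y in (0:ℝ)..1, G (f y) * (1 / P y) * Real.sin (2 * π * y) with hXdef
  have hXA := abs_le.mp hX
  -- `-2δX ≥ -2δA - 2|δ| · 2πC_Φ w I`
  have hkey : -(2 * δ * A) - 4 * π * CΦ * w * |δ| * I ≤ -(2 * δ * X) := by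
    have h1 : -(2 * δ * X) = -(2 * δ * A) - 2 * δ * (X - A) := by ring
    rw [h1]
    have h2 : 2 * δ * (X - A) ≤ 2 * |δ| * (2 * π * (CΦ * w) * I) := by
      calc 2 * δ * (X - A) ≤ |2 * δ * (X - A)| := le_abs_self _
        _ = 2 * |δ| * |X - A| := by rw [abs_mul, abs_mul, abs_two]
        _ ≤ 2 * |δ| * (2 * π * (CΦ * w) * I) := mul_le_mul_of_nonneg_left hX (by positivity)
    nlinarith [h2]
  linarith [hstep1, hkey]

end OneStep

/-! ### One step, averaged over the reduced mass -/

section OneStepMean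

variable {τ : ℝ → ℝ} {bm bp : ℝ}

/-- **One step averaged**: `∫ ρ_B(db) ∫_0^1 G(f_b(y)) dy ≥ (1 - 4π² C_Φ b_* w²) ∫_0^1 G` for
continuous `1`-periodic `0 ≤ G ≤ M` (`𝔼δ_B = c(w)𝔼B = 0`, `c(w) ≤ πw`, `𝔼|B| ≤ b_*`).
[cite: AjankiHuveneers2011, proof of Prop. 5.1, third observation] -/
theorem one_step_lower_mean (hτ : ReducedLawHyp τ bm bp) {ρB : Measure ℝ} [IsProbabilityMeasure ρB]
    (hρ : ρB = volume.withDensity fun s => ENNReal.ofReal (τ s))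
    {w : ℝ} (hw0 : 0 < w) (hwb : w ≤ pcW (max |bm| |bp|)) {CΦ : ℝ} (hCΦ0 : 0 ≤ CΦ)
    (hΦ : ∀ y, ∀ b ∈ Set.Icc bm bp, |ahPhi w y b| ≤ CΦ * w)
    {G : ℝ → ℝ} (hG : Continuous G) (hGper : Function.Periodic G 1) (hG0 : ∀ y, 0 ≤ G y)
    {M : ℝ} (hGM : ∀ y, G y ≤ M) :
    (1 - 4 * π ^ 2 * CΦ * (max |bm| |bp|) * w ^ 2) * (∫ z in (0:ℝ)..1, G z) ≤
      ∫ b, (∫ y in (0:ℝ)..1, G (ahStep w b y)) ∂ρB := by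
  set bstar : ℝ := max |bm| |bp| with hbstar
  have hbstar0 : 0 ≤ bstar := le_max_of_le_left (abs_nonneg _)
  obtain ⟨hw2, -, -⟩ := pc_small hbstar0 hw0.le hwb (show |(0:ℝ)| ≤ bstar by rw [abs_zero]; exact hbstar0)
  have hwπ : π * w / 2 < 1 := by linarith
  have hc := igC_pos hw0 hwπ
  have hc_hi := igC_le hw0.le hw2
  have hM0 : 0 ≤ M := (hG0 0).trans (hGM 0)
  set I : ℝ := ∫ z in (0:ℝ)..1, G z with hI
  set A : ℝ := ∫ z in (0:ℝ)..1, G z * Real.sin (2 * π * (z - ahTheta w)) with hA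
  have hI0 : 0 ≤ I := intervalIntegral.integral_nonneg zero_le_one fun z _ => hG0 z
  -- the per-`b` bound, on the support
  have hper : ∀ b ∈ Set.Icc bm bp,
      I - 2 * igDelta w b * A - 4 * π * CΦ * w * |igDelta w b| * I ≤ ∫ y in (0:ℝ)..1, G (ahStep w b y) := by
    intro b hb
    obtain ⟨-, -, hδ⟩ := pc_small hbstar0 hw0.le hwb (ReducedLawHyp.abs_le_of_mem hb)
    exact one_step_lower hw0.le hwπ (by linarith [hδ]) hG hGper hG0 (fun y => hΦ y b hb)
  -- the right-hand side is a bounded measurable function of `b`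
  set L : ℝ → ℝ := fun b => ∫ y in (0:ℝ)..1, G (ahStep w b y) with hL
  have hLb : ∀ b, |L b| ≤ M := by
    intro b
    have h := intervalIntegral.norm_integral_le_of_norm_le_const (a := (0:ℝ)) (b := 1) (C := M)
      (f := fun y => G (ahStep w b y)) fun y _ => by
        rw [Real.norm_eq_abs, abs_of_nonneg (hG0 _)]; exact hGM _
    simpa [hL] using h
  have hLm : AEStronglyMeasurable L ρB := by
    have h2 : Measurable fun p : ℝ × ℝ => G (ahStep w p.1 p.2) :=
      hG.measurable.comp ((measurable_ahStep₂ w).comp measurable_swap)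
    have h3 : StronglyMeasurable fun b => ∫ y, (fun p : ℝ × ℝ => G (ahStep w p.1 p.2)) (b, y)
        ∂(volume.restrict (Set.Ioc (0:ℝ) 1)) := h2.stronglyMeasurable.integral_prod_right'
    have hLeq : L = fun b => ∫ y, G (ahStep w b y) ∂(volume.restrict (Set.Ioc (0:ℝ) 1)) := by
      funext b; simp only [hL]; rw [intervalIntegral.integral_of_le zero_le_one]
    rw [hLeq]
    exact h3.aestronglyMeasurable
  have hLi : Integrable L ρB := ⟨hLm, HasFiniteIntegral.of_bounded (C := M)
    (ae_of_all _ fun b => by rw [Real.norm_eq_abs]; exact hLb b)⟩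
  -- the left-hand side minorant is integrable (affine in `δ_b = c(w) b`, `|δ_b|`)
  set R : ℝ → ℝ := fun b => I - 2 * igDelta w b * A - 4 * π * CΦ * w * |igDelta w b| * I with hR
  have hid : Integrable (fun b : ℝ => b) ρB := by
    refine ⟨measurable_id.aestronglyMeasurable, HasFiniteIntegral.of_bounded (C := bstar) ?_⟩
    filter_upwards [ae_rhoB_mem_Icc hτ hρ] with b hb
    rw [Real.norm_eq_abs]; exact ReducedLawHyp.abs_le_of_mem hb
  have habs : Integrable (fun b : ℝ => |b|) ρB := hid.abs
  have hRi : Integrable R ρB := by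
    have h1 : Integrable (fun b => 2 * igDelta w b * A) ρB := by
      have : (fun b => 2 * igDelta w b * A) = fun b => (2 * igC w * A) * b := by
        funext b; unfold igDelta; ring
      rw [this]; exact hid.const_mul _
    have h2 : Integrable (fun b => 4 * π * CΦ * w * |igDelta w b| * I) ρB := by
      have : (fun b => 4 * π * CΦ * w * |igDelta w b| * I) = fun b => (4 * π * CΦ * w * igC w * I) * |b| := by
        funext b; unfold igDelta; rw [abs_mul, abs_of_pos hc]; ring
      rw [this]; exact habs.const_mul _
    exact ((integrable_const I).sub h1).sub h2
  -- integrate the per-`b` bound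
  have hmono : ∫ b, R b ∂ρB ≤ ∫ b, L b ∂ρB := by
    refine integral_mono_ae hRi hLi ?_
    filter_upwards [ae_rhoB_mem_Icc hτ hρ] with b hb
    exact hper b hb
  -- evaluate `∫ R`
  have hRint : ∫ b, R b ∂ρB = I - 2 * igC w * A * (∫ b, b ∂ρB) - 4 * π * CΦ * w * igC w * I * ∫ b, |b| ∂ρB := by
    have e1 : (fun b => R b) = fun b => I - (2 * igC w * A) * b - (4 * π * CΦ * w * igC w * I) * |b| := by
      funext b; simp only [hR]; unfold igDelta; rw [abs_mul, abs_of_pos hc]; ring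
    have i1 : Integrable (fun b : ℝ => I - (2 * igC w * A) * b) ρB := (integrable_const I).sub (hid.const_mul _)
    have i2 : Integrable (fun b : ℝ => (4 * π * CΦ * w * igC w * I) * |b|) ρB := habs.const_mul _
    have i3 : Integrable (fun b : ℝ => (2 * igC w * A) * b) ρB := hid.const_mul _
    rw [e1, MeasureTheory.integral_sub i1 i2, MeasureTheory.integral_sub (integrable_const I) i3,
      MeasureTheory.integral_const, probReal_univ, one_smul, MeasureTheory.integral_const_mul,
      MeasureTheory.integral_const_mul]
  have hmean : ∫ b, b ∂ρB = 0 := integral_id_rhoB hτ hρ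
  have habs_le : ∫ b, |b| ∂ρB ≤ bstar := by
    calc ∫ b, |b| ∂ρB ≤ ∫ b, bstar ∂ρB := by
          refine integral_mono_ae habs (integrable_const _) ?_
          filter_upwards [ae_rhoB_mem_Icc hτ hρ] with b hb
          exact ReducedLawHyp.abs_le_of_mem hb
      _ = bstar := by rw [MeasureTheory.integral_const, probReal_univ, one_smul]
  rw [hRint, hmean, mul_zero, sub_zero] at hmono
  calc (1 - 4 * π ^ 2 * CΦ * bstar * w ^ 2) * I = I - 4 * π * CΦ * w * (π * w) * I * bstar := by ring
    _ ≤ I - 4 * π * CΦ * w * igC w * I * ∫ b, |b| ∂ρB := by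
        have h1 : 4 * π * CΦ * w * igC w * I * (∫ b, |b| ∂ρB) ≤ 4 * π * CΦ * w * (π * w) * I * bstar := by
          have h0 : 0 ≤ 4 * π * CΦ * w := by positivity
          calc 4 * π * CΦ * w * igC w * I * (∫ b, |b| ∂ρB) ≤ 4 * π * CΦ * w * igC w * I * bstar :=
                mul_le_mul_of_nonneg_left habs_le (by positivity)
            _ ≤ 4 * π * CΦ * w * (π * w) * I * bstar := by
                have := mul_le_mul_of_nonneg_left hc_hi h0
                have hIb : 0 ≤ I * bstar := mul_nonneg hI0 hbstar0
                nlinarith [mul_le_mul_of_nonneg_right this hIb]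
        linarith
    _ ≤ ∫ b, L b ∂ρB := hmono

end OneStepMean

/-! ### The chain started uniformly on a period -/

section Uniform

variable {τ : ℝ → ℝ} {bm bp : ℝ}

/-- `y ↦ X^y_n` is continuous for disorder in the small regime (`|δ(w, B_k)| < 1`). [folklore] -/
theorem continuous_ahPhase_start {w : ℝ} (hw0 : 0 ≤ w) (hw : π * w / 2 < 1) {B : ℕ → ℝ}
    (hB : ∀ k, |igDelta w (B k)| < 1) : ∀ n, Continuous fun y => ahPhase w y B n
  | 0 => continuous_id
  | n + 1 => by
    have ih := continuous_ahPhase_start hw0 hw hB n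
    have hstep : Continuous (ahStep w (B n)) :=
      continuous_iff_continuousAt.mpr fun y => (hasDerivAt_ahStep_x hw0 hw (hB n) y).continuousAt
    simp only [ahPhase_succ]
    exact hstep.comp ih

/-- A continuous `1`-periodic function is bounded (copy of the elementary fact, to keep this file
light). [folklore] -/
theorem exists_bound_of_periodic' {f : ℝ → ℝ} (hf : Continuous f) (hper : Function.Periodic f 1) :
    ∃ C : ℝ, 0 ≤ C ∧ ∀ y, |f y| ≤ C := by
  obtain ⟨C, hC⟩ := isCompact_Icc.exists_bound_of_continuousOn (s := Set.Icc (0 : ℝ) 1) hf.continuousOn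
  refine ⟨max C 0, le_max_right _ _, fun y => ?_⟩
  have hred : f y = f (Int.fract y) := by
    rw [Int.fract, show (y - ⌊y⌋ : ℝ) = y - (⌊y⌋ : ℤ) * (1 : ℝ) by ring, hper.sub_int_mul_eq]
  rw [hred]
  have hmem : Int.fract y ∈ Set.Icc (0 : ℝ) 1 := ⟨Int.fract_nonneg y, (Int.fract_lt_one y).le⟩
  exact ((Real.norm_eq_abs _).symm.le.trans (hC _ hmem)).trans (le_max_left _ _)

set_option maxHeartbeats 800000 in
/-- **The uniform start is almost sub-invariant.** There are `w₀ > 0` and `C ≥ 0` such that for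
`0 < w ≤ w₀` (where `Cw² ≤ 1/2`), every `n` and every continuous `1`-periodic `u ≥ 0`:
`(1 - Cw²)ⁿ ∫_0^1 u ≤ ∫_0^1 𝔼 u(X^y_n) dy`. For `w²n ≤ 1` the factor is `≥ e^{-2C}`.
[cite: AjankiHuveneers2011, proof of Prop. 5.1, third observation (`T^{n''}1 ∼ 1`)] -/
theorem uniform_start_lower (hτ : ReducedLawHyp τ bm bp) (ρB : Measure ℝ) [IsProbabilityMeasure ρB]
    (hρ : ρB = volume.withDensity fun s => ENNReal.ofReal (τ s)) :
    ∃ w₀ : ℝ, 0 < w₀ ∧ ∃ C : ℝ, 0 ≤ C ∧ (∀ w ∈ Set.Ioc 0 w₀, C * w ^ 2 ≤ 1 / 2) ∧ ∀ w ∈ Set.Ioc 0 w₀, ∀ n : ℕ,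
      ∀ u : ℝ → ℝ, Continuous u → Function.Periodic u 1 → (∀ y, 0 ≤ u y) →
        (1 - C * w ^ 2) ^ n * (∫ y in (0:ℝ)..1, u y) ≤
          ∫ y in (0:ℝ)..1, (∫ B, u (ahPhase w y (finExt B) n) ∂(Measure.pi fun _ : Fin n => ρB)) := by
  set bstar : ℝ := max |bm| |bp| with hbstar
  have hbstar0 : 0 ≤ bstar := le_max_of_le_left (abs_nonneg _)
  obtain ⟨wΦ, hwΦ, CΦ, hCΦ0, hΦ⟩ := ahPhi_abs_le bm bp
  set C : ℝ := 4 * π ^ 2 * CΦ * bstar with hCdef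
  have hC0 : 0 ≤ C := by rw [hCdef]; positivity
  set w₀ : ℝ := min (min wΦ (pcW bstar)) (1 / Real.sqrt (2 * C + 1)) with hw₀
  have hw₀0 : 0 < w₀ := by
    rw [hw₀]; exact lt_min (lt_min hwΦ (pcW_pos hbstar0)) (by positivity)
  have hCw : ∀ w ∈ Set.Ioc 0 w₀, C * w ^ 2 ≤ 1 / 2 := by
    intro w hw
    have hw0 : 0 < w := hw.1
    have h1 : w ≤ 1 / Real.sqrt (2 * C + 1) := hw.2.trans (min_le_right _ _)
    have hs : 0 < Real.sqrt (2 * C + 1) := Real.sqrt_pos.mpr (by positivity)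
    have h2 : w * Real.sqrt (2 * C + 1) ≤ 1 := by rwa [le_div_iff₀ hs] at h1
    have h3 : w ^ 2 * (2 * C + 1) ≤ 1 := by
      have := mul_le_mul h2 h2 (by positivity) zero_le_one
      rw [one_mul] at this
      calc w ^ 2 * (2 * C + 1) = (w * Real.sqrt (2 * C + 1)) * (w * Real.sqrt (2 * C + 1)) := by
            rw [mul_mul_mul_comm, Real.mul_self_sqrt (by positivity)]; ring
        _ ≤ 1 := this
    nlinarith [sq_nonneg w]
  refine ⟨w₀, hw₀0, C, hC0, hCw, ?_⟩
  intro w hw n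
  obtain ⟨hw0, hwle⟩ := hw
  have hwΦ' : w ∈ Set.Ioc 0 wΦ := ⟨hw0, hwle.trans ((min_le_left _ _).trans (min_le_left _ _))⟩
  have hwb : w ≤ pcW bstar := hwle.trans ((min_le_left _ _).trans (min_le_right _ _))
  obtain ⟨hw2, -, -⟩ := pc_small hbstar0 hw0.le hwb (show |(0:ℝ)| ≤ bstar by rw [abs_zero]; exact hbstar0)
  have hwπ : π * w / 2 < 1 := by linarith
  have hCΦw : 0 ≤ CΦ * w := mul_nonneg hCΦ0 hw0.le
  have hΦ' : ∀ y, ∀ b ∈ Set.Icc bm bp, |ahPhi w y b| ≤ CΦ * w := fun y b hb =>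
    (hΦ w hwΦ' y b hb).trans (by
      have := Real.sin_sq_le_one (π * y)
      nlinarith [hCΦw])
  have hfac0 : 0 ≤ 1 - C * w ^ 2 := by linarith [hCw w ⟨hw0, hwle⟩]
  -- induction on `n`
  induction n with
  | zero =>
    intro u _ _ _
    simp
  | succ n ih =>
    intro u huc huper hu0
    obtain ⟨M, hM0, hM⟩ := exists_bound_of_periodic' huc huper
    have huM : ∀ y, u y ≤ M := fun y => (le_abs_self _).trans (hM y)
    set μn := (Measure.pi fun _ : Fin n => ρB) with hμn
    set F : ℝ → ℝ := fun y => ∫ B, u (ahPhase w y (finExt B) n) ∂μn with hF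
    -- a.e. regime for the disorder
    have hcube : ∀ᵐ B ∂μn, ∀ k, |igDelta w (finExt B k)| < 1 := by
      filter_upwards [ae_pi_cube hτ hρ n] with B hB k
      have hk : finExt B k ∈ Set.Icc bm bp := by
        by_cases h : k < n
        · rw [finExt_of_lt _ h]; exact ⟨(hB _).1, (hB _).2⟩
        · simp only [finExt, h, ↓reduceDIte]; exact ⟨hτ.bm_nonpos, hτ.bp_nonneg⟩
      obtain ⟨-, -, hδ⟩ := pc_small hbstar0 hw0.le hwb (ReducedLawHyp.abs_le_of_mem hk)
      linarith [hδ]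
    -- `F` is continuous, periodic, `0 ≤ F ≤ M`
    have hmeasU : ∀ y, AEStronglyMeasurable (fun B : Fin n → ℝ => u (ahPhase w y (finExt B) n)) μn := fun y =>
      (huc.measurable.comp (measurable_ahPhase_pi w y n)).aestronglyMeasurable
    have hFc : Continuous F := by
      refine continuous_of_dominated (F := fun y B => u (ahPhase w y (finExt B) n)) (bound := fun _ => M)
        (fun y => hmeasU y) (fun y => ae_of_all _ fun B => ?_) (integrable_const M) ?_
      · rw [Real.norm_eq_abs]; exact hM _
      · filter_upwards [hcube] with B hB
        exact huc.comp (continuous_ahPhase_start hw0.le hwπ hB n)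
    have hFper : Function.Periodic F 1 := fun y => by
      simp only [hF]
      refine integral_congr_ae (ae_of_all _ fun B => ?_)
      show u (ahPhase w (y + 1) (finExt B) n) = u (ahPhase w y (finExt B) n)
      rw [ahPhase_add_one, huper]
    have hF0 : ∀ y, 0 ≤ F y := fun y => integral_nonneg fun B => hu0 _
    have hFM : ∀ y, F y ≤ M := fun y => by
      calc F y ≤ ∫ B, M ∂μn := integral_mono_of_nonneg (ae_of_all _ fun B => hu0 _) (integrable_const M)
              (ae_of_all _ fun B => huM _)
        _ = M := by rw [MeasureTheory.integral_const, probReal_univ, one_smul]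
    -- the Markov step: `𝔼 u(X^y_{n+1}) = ∫ F(f_b(y)) ρ_B(db)`
    have hstep : ∀ y, ∫ B, u (ahPhase w y (finExt B) (n + 1)) ∂(Measure.pi fun _ : Fin (n + 1) => ρB) =
        ∫ b, F (ahStep w b y) ∂ρB := by
      intro y
      have hint : Integrable (fun B : Fin (n + 1) → ℝ => u (ahPhase w y (finExt B) (n + 1)))
          (Measure.pi fun _ : Fin (n + 1) => ρB) :=
        ⟨(huc.measurable.comp (measurable_ahPhase_pi w y (n + 1))).aestronglyMeasurable,
          HasFiniteIntegral.of_bounded (C := M) (ae_of_all _ fun B => by rw [Real.norm_eq_abs]; exact hM _)⟩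
      rw [integral_pi_succ_cons ρB n hint]
      refine integral_congr_ae (ae_of_all _ fun b => ?_)
      simp only [hF]
      refine integral_congr_ae (ae_of_all _ fun B => ?_)
      show u (ahPhase w y (finExt (Fin.cons b B : Fin (n + 1) → ℝ)) (n + 1)) = u (ahPhase w (ahStep w b y) (finExt B) n)
      rw [ahPhase_finExt_cons]
    -- Fubini
    have hprod : Integrable (Function.uncurry fun (y : ℝ) (b : ℝ) => F (ahStep w b y))
        ((volume.restrict (Set.Ioc (0:ℝ) 1)).prod ρB) := by
      have hm : Measurable (Function.uncurry fun (y : ℝ) (b : ℝ) => F (ahStep w b y)) :=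
        hFc.measurable.comp (measurable_ahStep₂ w)
      refine ⟨hm.aestronglyMeasurable, HasFiniteIntegral.of_bounded (C := M) (ae_of_all _ fun p => ?_)⟩
      show ‖F (ahStep w p.2 p.1)‖ ≤ M
      rw [Real.norm_eq_abs, abs_of_nonneg (hF0 _)]; exact hFM _
    have hswap : ∫ y in (0:ℝ)..1, ∫ b, F (ahStep w b y) ∂ρB = ∫ b, (∫ y in (0:ℝ)..1, F (ahStep w b y)) ∂ρB := by
      rw [intervalIntegral.integral_of_le zero_le_one, integral_integral_swap hprod]
      refine integral_congr_ae (ae_of_all _ fun b => ?_)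
      show ∫ y in Set.Ioc (0:ℝ) 1, F (ahStep w b y) = ∫ y in (0:ℝ)..1, F (ahStep w b y)
      rw [intervalIntegral.integral_of_le zero_le_one]
    -- assemble
    have hone := one_step_lower_mean hτ hρ hw0 hwb hCΦ0 hΦ' hFc hFper hF0 hFM
    rw [← hbstar] at hone
    have hih := ih u huc huper hu0
    calc (1 - C * w ^ 2) ^ (n + 1) * ∫ y in (0:ℝ)..1, u y
        = (1 - C * w ^ 2) * ((1 - C * w ^ 2) ^ n * ∫ y in (0:ℝ)..1, u y) := by ring
      _ ≤ (1 - C * w ^ 2) * ∫ y in (0:ℝ)..1, F y := mul_le_mul_of_nonneg_left hih hfac0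
      _ = (1 - 4 * π ^ 2 * CΦ * bstar * w ^ 2) * ∫ y in (0:ℝ)..1, F y := by rw [hCdef]
      _ ≤ ∫ b, (∫ y in (0:ℝ)..1, F (ahStep w b y)) ∂ρB := hone
      _ = ∫ y in (0:ℝ)..1, ∫ b, F (ahStep w b y) ∂ρB := hswap.symm
      _ = ∫ y in (0:ℝ)..1, ∫ B, u (ahPhase w y (finExt B) (n + 1)) ∂(Measure.pi fun _ : Fin (n + 1) => ρB) := by
          refine intervalIntegral.integral_congr fun y _ => (hstep y).symm

end Uniform

end Literature.Barriers.AtomisticToContinuum.HeatConduction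

end
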